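import Summits.AtomisticToContinuum.Crystallization.Theorems.CoarseGrains.Negative.PredicateAPI
import Summits.AtomisticToContinuum.Crystallization.Theorems.CoarseGrains.Negative.VacuityThreshold

/-!
# `FineGrains` / Negative: vacuity thresholds — radius below `199/200` (any `ε`), tolerance above `max(ρ, 11/10)`

Negative knowledge for crux `stmt-AtomisticToContinuum-9330` (`ExcessDecayLiouville.FineGrains`),
standing crux-disprover seat `refuter-cdisprove-stmt-AtomisticToContinuum-9330-0` (2026-08-16); builds
on the sibling kit `CoarseGrains/Negative/{PredicateAPI, VacuityThreshold}` (independent of the companion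
file `FineGrains/Negative/LoadBearing`; the matrix `∃ c t A, Adm A ∧ Near (range x) c ρ t A ε` is
written out, it is `LoadBearing.HasFineBall ρ ε x` by `Iff.rfl`).  Nothing here closes an item; no theorem
concludes a Theses decl (only the MATRIX of the crux is settled, at small radius / large tolerance, for
ALL configurations).

* `near_trivial_collapsed` / `hasFineBall_of_lt`: for `ρ < 199/200` the matrix holds for every bounded
  `X ⊆ ℝ³` at EVERY real `ε` — collapsed datum `t 0 = t 1` (allowed: `FineGrains` has no `Inner`
  clause), `A = (199/200)·id` (admissible with equality), origin parked far from `X`, ball centred at the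
  deep hole `w + √(2/3)e₃` of `Λ`, which is at distance `≥ 1` from `Λ` (`one_le_norm_sq_lam_sub_hole`).
  Sharper than `7/10` for `CoarseGrains` (`VacuityThreshold.near_trivial_of_le`) because the collapse is
  allowed; bracketed above by `FineGrains/Negative/LoadBearing.one_le_threshold` (`ρ ≥ 11/10 ⇒ N₀ ≥ 1`).
* `hasFineBall_of_large_tol`: for `ρ ≤ ε`, `11/10 ≤ ε`, `N ≥ 1` every configuration has a fine ball
  (centred at a particle, isotropic datum `0.97·id`, `adm_smul_id`).  So the crux has content exactly in
  the region `ρ ≥ 199/200`, `0 < ε < max(ρ, 11/10)`.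
* `exists_int_tri_near` / `exists_lam_near_one` / `exists_site_near_sharp`: the SHARP covering radii
  (`1/√3` in-plane, `1` for `Λ`, `199/200` for admissible site sets — improving the kit's `11/10`);
  hence `not_near_empty_of_le` / `fineGrains_matrix_fails_empty`: the vacuity threshold `199/200` is
  exact (from `ρ ≥ 199/200` the empty configuration fails, `N₀ ≥ 1`).
-/

noncomputable section

open Literature.MathematicalPhysics.StatisticalMechanics

namespace Summit.AtomisticToContinuum.Crystallization.Theorems.FineGrains.Negative.RadiusVacuity

open Summit.AtomisticToContinuum.Crystallization.Theorems.CoarseGrains.Negative.PredicateAPI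
open Summit.AtomisticToContinuum.Crystallization.Theorems.CoarseGrains.Negative.VacuityThreshold

/-! ## (b) Vacuity in the radius: for `ρ < 199/200` the matrix holds for EVERY bounded set at EVERY `ε`

Specific to `FineGrains`: the inner displacement is free, so the COLLAPSED datum `t 0 = t 1` is allowed;
its site set is the Bravais lattice `F + s·Λ` (`s = 199/200`, admissible with equality), whose deep hole
`F + s(w + √(2/3)e₃)` is at distance `≥ s` from every site (`Λ` has covering radius exactly `1`).  For
`CoarseGrains`, whose `Inner` forbids the collapse, the sibling seat's threshold is `7/10`
(`VacuityThreshold.near_trivial_of_le`); from `ρ ≥ 11/10` the matrix has content in both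
(`one_le_threshold`). -/

/-- Coordinates of the deep hole `w + √(2/3)e₃ = (1/2, √3/6, √(2/3))` of `Λ` (`w = barlowOffset 1`).
[folklore] -/
theorem hole_apply :
    (barlowOffset 1 + layerNormal (Real.sqrt (2 / 3)) : E3) 0 = 1 / 2 ∧
    (barlowOffset 1 + layerNormal (Real.sqrt (2 / 3)) : E3) 1 = Real.sqrt 3 / 6 ∧
    (barlowOffset 1 + layerNormal (Real.sqrt (2 / 3)) : E3) 2 = Real.sqrt (2 / 3) := by
  refine ⟨?_, ?_, ?_⟩ <;> simp [barlowOffset, layerNormal]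

/-- `‖w‖² = w₀² + w₁² + w₂²` in `ℝ³`. [folklore] -/
theorem norm_sq_eq (w : E3) : ‖w‖ ^ 2 = w 0 ^ 2 + w 1 ^ 2 + w 2 ^ 2 := by
  rw [EuclideanSpace.norm_eq, Real.sq_sqrt (by positivity), Fin.sum_univ_three]
  simp [Real.norm_eq_abs, sq_abs]

/-- The deep hole has norm `≤ 1` (indeed `= 1`). [folklore] -/
theorem norm_hole_le_one : ‖(barlowOffset 1 + layerNormal (Real.sqrt (2 / 3)) : E3)‖ ≤ 1 := by
  obtain ⟨g0, g1, g2⟩ := hole_apply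
  have hsq : ‖(barlowOffset 1 + layerNormal (Real.sqrt (2 / 3)) : E3)‖ ^ 2 ≤ 1 := by
    rw [norm_sq_eq, g0, g1, g2]
    nlinarith [Real.sq_sqrt (show (0 : ℝ) ≤ 3 by norm_num), sqrt23_sq]
  nlinarith [norm_nonneg (barlowOffset 1 + layerNormal (Real.sqrt (2 / 3)) : E3)]

/-- `i² + ij + j² − i − j ≥ 0` on `ℤ²` (`int_quad_nonneg₁` at `(−i, −j)`). [folklore] -/
theorem int_quad_nonneg₃ (i j : ℤ) : 0 ≤ i * i + i * j + j * j - i - j := by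
  have h := int_quad_nonneg₁ (-i) (-j)
  nlinarith [h]

/-- Real form of `int_quad_nonneg₃`. -/
theorem real_quad_nonneg₃ (i j : ℤ) : (0 : ℝ) ≤ (i : ℝ) * i + i * j + j * j - i - j := by
  exact_mod_cast int_quad_nonneg₃ i j

/-- `(2k − 1)² ≥ 1` for `k ∈ ℤ`. [folklore] -/
theorem one_le_sq_two_mul_sub_one (k : ℤ) : (1 : ℝ) ≤ (2 * (k : ℝ) - 1) ^ 2 := by
  have h : (1 : ℤ) ≤ (2 * k - 1) ^ 2 := by
    rcases le_or_gt k 0 with hk | hk <;> nlinarith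
  exact_mod_cast h

/-- **Every vector of `Λ` is at distance `≥ 1` from the deep hole** `w + √(2/3)e₃`:
`‖z − hole‖² = (i² + ij + j² − i − j + 1/3) + (2/3)(2k − 1)² ≥ 1/3 + 2/3`. [folklore] -/
theorem one_le_norm_sq_lam_sub_hole (i j k : ℤ) :
    (1 : ℝ) ≤ ‖((i : ℝ) • triangularVec₁ 1 + (j : ℝ) • triangularVec₂ 1 +
      (k : ℝ) • layerNormal (2 * Real.sqrt (2 / 3)) : E3) -
      (barlowOffset 1 + layerNormal (Real.sqrt (2 / 3)))‖ ^ 2 := by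
  obtain ⟨g0, g1, g2⟩ := hole_apply
  obtain ⟨h0, h1, h2⟩ := lamVec_apply (i : ℝ) j k
  rw [norm_sq_eq]
  simp only [PiLp.sub_apply]
  rw [h0, h1, h2, g0, g1, g2]
  have h3 : Real.sqrt 3 ^ 2 = 3 := Real.sq_sqrt (by norm_num)
  have e1 : ((j : ℝ) * (Real.sqrt 3 / 2) - Real.sqrt 3 / 6) ^ 2 = 3 * ((j : ℝ) / 2 - 1 / 6) ^ 2 := by
    have : (j : ℝ) * (Real.sqrt 3 / 2) - Real.sqrt 3 / 6 = Real.sqrt 3 * ((j : ℝ) / 2 - 1 / 6) := by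
      ring
    rw [this, mul_pow, h3]
  have e2 : ((k : ℝ) * (2 * Real.sqrt (2 / 3)) - Real.sqrt (2 / 3)) ^ 2 =
      2 / 3 * (2 * (k : ℝ) - 1) ^ 2 := by
    have : (k : ℝ) * (2 * Real.sqrt (2 / 3)) - Real.sqrt (2 / 3) =
        Real.sqrt (2 / 3) * (2 * (k : ℝ) - 1) := by ring
    rw [this, mul_pow, sqrt23_sq]
  rw [e1, e2]
  have hq := real_quad_nonneg₃ i j
  have hk := one_le_sq_two_mul_sub_one k
  nlinarith [hq, hk]

/-- **Below radius `199/200` the matrix is vacuous — for every bounded `X` and EVERY real `ε`** (even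
`ε ≤ 0`): collapsed datum `A = (199/200)·id` (admissible, with equality `‖A − 0.97·id‖ = 1/40`),
`t 0 = t 1 = F` parked farther than `ρ` from `X`, ball centred at the deep hole `c = F + A(w + √(2/3)e₃)`;
every site `F + A z` is `≥ 199/200 > ρ` from `c` (`one_le_norm_sq_lam_sub_hole`) and no point of `X` is
within `ρ` of `c`, so both clauses of `Near` are vacuous. [folklore] -/
theorem near_trivial_collapsed {ρ : ℝ} (hρ : ρ < 199 / 200) {X : Set E3} (hX : Bornology.IsBounded X)
    (ε : ℝ) :
    ∃ (c : E3) (t : Fin 2 → E3) (A : E3 →L[ℝ] E3), Adm A ∧ Near X c ρ t A ε := by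
  obtain ⟨M, hMpos, hM⟩ := hX.exists_pos_norm_le
  have hhole_norm := norm_hole_le_one
  set hole : E3 := barlowOffset 1 + layerNormal (Real.sqrt (2 / 3)) with hhole
  set u : E3 := triangularVec₁ 1 with hu
  have hu1 : ‖u‖ = 1 := norm_triangularVec₁
  set A : E3 →L[ℝ] E3 := (199 / 200 : ℝ) • ContinuousLinearMap.id ℝ E3 with hAdef
  have hA : ∀ w : E3, A w = (199 / 200 : ℝ) • w := fun w => by simp [hAdef]
  set F : E3 := (M + 3) • u with hF
  set t : Fin 2 → E3 := ![F, F] with ht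
  set c : E3 := F + A hole with hc
  have htm : ∀ m : Fin 2, t m = F := by
    intro m
    fin_cases m <;> simp [ht]
  refine ⟨c, t, A, ?_, ?_, ?_⟩
  · refine ⟨LinearIsometryEquiv.refl ℝ E3, ?_⟩
    have h0 : A - (97 / 100 : ℝ) •
        ((LinearIsometryEquiv.refl ℝ E3).toContinuousLinearEquiv : E3 →L[ℝ] E3) =
        (1 / 40 : ℝ) • ContinuousLinearMap.id ℝ E3 := by
      ext w
      simp [hAdef]
      ring
    rw [h0, norm_smul, ContinuousLinearMap.norm_id, Real.norm_eq_abs]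
    norm_num
  · intro p hp hpc
    exfalso
    have h1 : ‖F‖ = M + 3 := by
      rw [hF, norm_smul, hu1, mul_one, Real.norm_eq_abs, abs_of_pos (by linarith)]
    have h2 : ‖A hole‖ ≤ 1 := by
      rw [hA, norm_smul, Real.norm_eq_abs, abs_of_pos (by norm_num)]
      nlinarith [norm_nonneg hole]
    have h3 : ‖F‖ - ‖A hole‖ ≤ ‖c‖ := by rw [hc]; exact norm_sub_le_norm_add _ _
    have h4 : ‖c‖ - ‖p‖ ≤ dist p c := by
      rw [dist_comm, dist_eq_norm]; exact norm_sub_norm_le c p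
    have h5 := hM p hp
    linarith
  · intro m z hz hzc
    exfalso
    obtain ⟨i, j, k, rfl⟩ := hz
    set zz : E3 := (i : ℝ) • triangularVec₁ 1 + (j : ℝ) • triangularVec₂ 1 +
      (k : ℝ) • layerNormal (2 * Real.sqrt (2 / 3)) with hzz
    rw [htm m, hc, dist_eq_norm] at hzc
    have e : F + A zz - (F + A hole) = A (zz - hole) := by rw [map_sub]; abel
    rw [e, hA, norm_smul, Real.norm_eq_abs, abs_of_pos (by norm_num)] at hzc
    have hsq := one_le_norm_sq_lam_sub_hole i j k
    have hn : 1 ≤ ‖zz - hole‖ := by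
      nlinarith [norm_nonneg (zz - hole), hsq]
    linarith

/-- Corollary: **for `ρ < 199/200` every finite configuration has a fine ball at every tolerance** — the
radius quantifier of `FineGrains` carries content only from `ρ ≥ 199/200` on (provers may take
`N₀ := 0` below); the threshold is bracketed by `one_le_threshold` (`ρ ≥ 11/10 ⇒ N₀ ≥ 1`). [folklore] -/
theorem hasFineBall_of_lt {ρ : ℝ} (hρ : ρ < 199 / 200) (ε : ℝ) {N : ℕ} (x : Fin N → E3) :
    ∃ (c : E3) (t : Fin 2 → E3) (A : E3 →L[ℝ] E3), Adm A ∧ Near (Set.range x) c ρ t A ε :=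
  near_trivial_collapsed hρ (Set.finite_range x).isBounded ε


/-! ## (b′) Vacuity in the tolerance: for `ε ≥ max(ρ, 11/10)` every non-empty configuration has a fine ball

Centre the ball at a particle `p` and take the isotropic datum `0.97·id` based at `p`: every site in
`B_ρ(p)` is within `ρ ≤ ε` of `p`, and every particle is within the covering radius `11/10 ≤ ε` of a site.
So the tolerance quantifier carries content only for `ε < max(ρ, 11/10)`; together with (b) the contentful
parameter region of the crux is `ρ ≥ 199/200`, `0 < ε < max(ρ, 11/10)` (and `ε → 0` is where it lives). -/

/-- The isotropic cell `0.97·id` is admissible. [folklore] -/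
theorem adm_smul_id : Adm ((97 / 100 : ℝ) • ContinuousLinearMap.id ℝ E3) := by
  refine ⟨LinearIsometryEquiv.refl ℝ E3, ?_⟩
  have h0 : (97 / 100 : ℝ) • ContinuousLinearMap.id ℝ E3 - (97 / 100 : ℝ) •
      ((LinearIsometryEquiv.refl ℝ E3).toContinuousLinearEquiv : E3 →L[ℝ] E3) = 0 := by
    ext w
    simp
  rw [h0, norm_zero]; norm_num

/-- **Large tolerance is vacuous:** for `ρ ≤ ε`, `11/10 ≤ ε` and `N ≥ 1` every configuration has a fine
ball (centred at a particle, datum `0.97·id` based there). [folklore] -/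
theorem hasFineBall_of_large_tol {ρ ε : ℝ} (hρε : ρ ≤ ε) (hε : 11 / 10 ≤ ε) {N : ℕ} (hN : 1 ≤ N)
    (x : Fin N → E3) :
    ∃ (c : E3) (t : Fin 2 → E3) (A : E3 →L[ℝ] E3), Adm A ∧ Near (Set.range x) c ρ t A ε := by
  set p : E3 := x ⟨0, hN⟩ with hp
  set A : E3 →L[ℝ] E3 := (97 / 100 : ℝ) • ContinuousLinearMap.id ℝ E3 with hAdef
  have hA : Adm A := adm_smul_id
  refine ⟨p, ![p, p], A, hA, ?_, ?_⟩
  · intro q _ _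
    obtain ⟨z, hz, hzq⟩ := exists_site_near hA p q
    refine ⟨0, z, hz, ?_⟩
    have h0 : (![p, p] : Fin 2 → E3) 0 = p := by simp
    rw [h0, dist_comm]
    exact hzq.trans hε
  · intro m z _ hzc
    exact ⟨p, ⟨⟨0, hN⟩, rfl⟩, by rw [dist_comm]; exact hzc.trans hρε⟩

/-! ## (b″) The sharp covering radius: `Λ` covers `ℝ³` at radius `1`, admissible site sets at `199/200`

Hence the vacuity threshold of (b) is EXACT: below `199/200` the matrix holds for every bounded set,
from `199/200` on it fails for the empty configuration (`N₀ ≥ 1`). -/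

/-- In-plane covering of the unit triangular lattice: for real lattice coordinates `(α, β)` there are
integers `(i, j)` with `(α−i)² + (α−i)(β−j) + (β−j)² ≤ 1/3` (circumradius `1/√3` of the unit triangle:
the barycentric average of the squared distances to the three vertices of the containing triangle is
`≤ 1/3`). [folklore] -/
theorem exists_int_tri_near (α β : ℝ) :
    ∃ i j : ℤ, (α - i) ^ 2 + (α - i) * (β - j) + (β - j) ^ 2 ≤ 1 / 3 := by
  set s : ℝ := Int.fract α with hs
  set t : ℝ := Int.fract β with ht
  have hs0 : 0 ≤ s := Int.fract_nonneg α
  have hs1 : s < 1 := Int.fract_lt_one α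
  have ht0 : 0 ≤ t := Int.fract_nonneg β
  have ht1 : t < 1 := Int.fract_lt_one β
  have hα : α - ⌊α⌋ = s := by rw [hs, Int.fract]
  have hβ : β - ⌊β⌋ = t := by rw [ht, Int.fract]
  -- squared distances (in the quadratic form) to the four corners of the cell
  by_cases hst : s + t ≤ 1
  · -- lower triangle: corners (0,0), (1,0), (0,1)
    by_cases h0 : s ^ 2 + s * t + t ^ 2 ≤ 1 / 3
    · exact ⟨⌊α⌋, ⌊β⌋, by rw [hα, hβ]; exact h0⟩
    by_cases h1 : (s - 1) ^ 2 + (s - 1) * t + t ^ 2 ≤ 1 / 3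
    · refine ⟨⌊α⌋ + 1, ⌊β⌋, ?_⟩
      push_cast
      have e1 : α - (⌊α⌋ + 1) = s - 1 := by linarith
      rw [e1, hβ]; exact h1
    · refine ⟨⌊α⌋, ⌊β⌋ + 1, ?_⟩
      push_cast
      have e2 : β - (⌊β⌋ + 1) = t - 1 := by linarith
      rw [hα, e2]
      push Not at h0 h1
      -- barycentric average ≤ 1/3 forces the third distance small
      nlinarith [mul_nonneg hs0 ht0, mul_nonneg hs0 (by linarith : (0:ℝ) ≤ 1 - s - t),
        mul_nonneg ht0 (by linarith : (0:ℝ) ≤ 1 - s - t), sq_nonneg (s - t), sq_nonneg (s + t - 2/3)]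
  · -- upper triangle: corners (1,1), (1,0), (0,1); substitute s' = 1 - s, t' = 1 - t
    push Not at hst
    by_cases h0 : (s - 1) ^ 2 + (s - 1) * (t - 1) + (t - 1) ^ 2 ≤ 1 / 3
    · refine ⟨⌊α⌋ + 1, ⌊β⌋ + 1, ?_⟩
      push_cast
      have e1 : α - (⌊α⌋ + 1) = s - 1 := by linarith
      have e2 : β - (⌊β⌋ + 1) = t - 1 := by linarith
      rw [e1, e2]; exact h0
    by_cases h1 : (s - 1) ^ 2 + (s - 1) * t + t ^ 2 ≤ 1 / 3
    · refine ⟨⌊α⌋ + 1, ⌊β⌋, ?_⟩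
      push_cast
      have e1 : α - (⌊α⌋ + 1) = s - 1 := by linarith
      rw [e1, hβ]; exact h1
    · refine ⟨⌊α⌋, ⌊β⌋ + 1, ?_⟩
      push_cast
      have e2 : β - (⌊β⌋ + 1) = t - 1 := by linarith
      rw [hα, e2]
      push Not at h0 h1
      nlinarith [mul_nonneg (by linarith : (0:ℝ) ≤ 1 - s) (by linarith : (0:ℝ) ≤ 1 - t),
        mul_nonneg (by linarith : (0:ℝ) ≤ 1 - s) (by linarith : (0:ℝ) ≤ s + t - 1),
        mul_nonneg (by linarith : (0:ℝ) ≤ 1 - t) (by linarith : (0:ℝ) ≤ s + t - 1),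
        sq_nonneg (s - t), sq_nonneg (s + t - 4/3)]


/-- **Sharp covering radius of `Λ`:** every point of `ℝ³` is within distance `1` of `Λ` (in-plane
circumradius `1/√3`, half layer period `√(2/3)`; `1/3 + 2/3 = 1`; attained at the deep holes). [folklore] -/
theorem exists_lam_near_one (y : E3) : ∃ z ∈ Lam, ‖y - z‖ ≤ 1 := by
  set c₃ : ℝ := 2 * Real.sqrt (2 / 3) with hc₃
  set sr : ℝ := Real.sqrt 3 / 2 with hsr
  have hc₃pos : 0 < c₃ := by rw [hc₃]; positivity
  have hsrpos : 0 < sr := by rw [hsr]; positivity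
  have hss : sr ^ 2 = 3 / 4 := by
    rw [hsr, div_pow, Real.sq_sqrt (show (0 : ℝ) ≤ 3 by norm_num)]; norm_num
  have hcc : c₃ ^ 2 = 8 / 3 := by rw [hc₃, mul_pow, sqrt23_sq]; norm_num
  -- lattice coordinates of the in-plane part
  set β : ℝ := y 1 / sr with hβ
  set α : ℝ := y 0 - β / 2 with hα
  obtain ⟨i, j, hij⟩ := exists_int_tri_near α β
  set k : ℤ := round (y 2 / c₃) with hk
  refine ⟨_, mem_lam i j k, ?_⟩
  set z : E3 := (i : ℝ) • triangularVec₁ 1 + (j : ℝ) • triangularVec₂ 1 +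
      (k : ℝ) • layerNormal (2 * Real.sqrt (2 / 3)) with hz
  obtain ⟨h0, h1, h2⟩ := lamVec_apply (i : ℝ) j k
  have e0 : (y - z) 0 = (α - i) + (β - j) / 2 := by
    rw [PiLp.sub_apply, h0, hα]; ring
  have e1 : (y - z) 1 = sr * (β - j) := by
    rw [PiLp.sub_apply, h1, hβ, hsr]; field_simp
  have e2 : (y - z) 2 = c₃ * (y 2 / c₃ - k) := by
    rw [PiLp.sub_apply, h2, hc₃]; field_simp
  have b2 : |(y - z) 2| ≤ c₃ * (1 / 2) := by
    rw [e2, abs_mul, abs_of_pos hc₃pos]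
    exact mul_le_mul_of_nonneg_left (by rw [hk]; exact abs_sub_round _) hc₃pos.le
  have hsq : ‖y - z‖ ^ 2 ≤ 1 := by
    rw [EuclideanSpace.norm_eq, Real.sq_sqrt (by positivity), Fin.sum_univ_three]
    simp only [Real.norm_eq_abs, sq_abs]
    have a2 : (y - z) 2 ^ 2 ≤ (c₃ * (1 / 2)) ^ 2 := sq_le_sq' (abs_le.1 b2).1 (abs_le.1 b2).2
    rw [mul_pow, hcc] at a2
    have hin : (y - z) 0 ^ 2 + (y - z) 1 ^ 2 =
        (α - i) ^ 2 + (α - i) * (β - j) + (β - j) ^ 2 := by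
      rw [e0, e1, mul_pow, hss]; ring
    linarith
  nlinarith [norm_nonneg (y - z)]

/-- **Sharp covering radius of admissible site sets:** every point of `ℝ³` is within `199/200` of a
site `t₀ + A z`, `z ∈ Λ`, of any admissible datum (`A` onto, `‖A‖ ≤ 199/200`). [folklore] -/
theorem exists_site_near_sharp {A : E3 →L[ℝ] E3} (hA : Adm A) (t₀ c : E3) :
    ∃ z ∈ Lam, dist (t₀ + A z) c ≤ 199 / 200 := by
  obtain ⟨y, hy⟩ := adm_surjective hA (c - t₀)
  obtain ⟨z, hz, hyz⟩ := exists_lam_near_one y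
  refine ⟨z, hz, ?_⟩
  have h : t₀ + A z - c = A (z - y) := by rw [map_sub, hy]; abel
  rw [dist_eq_norm, h]
  calc ‖A (z - y)‖ ≤ (199 / 200) * ‖z - y‖ := adm_norm_le hA _
    _ ≤ (199 / 200) * 1 := by rw [norm_sub_rev]; gcongr
    _ = 199 / 200 := by norm_num

/-- **The vacuity threshold `199/200` is exact:** from `ρ ≥ 199/200` on, the empty configuration has
no fine ball at any tolerance (the site within `199/200` of the centre owns no particle), so any `N₀`
valid at such a radius is `≥ 1`; below `199/200` every bounded set has one (`near_trivial_collapsed`).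
[folklore] -/
theorem not_near_empty_of_le {ρ : ℝ} (hρ : 199 / 200 ≤ ρ) {c : E3} {t : Fin 2 → E3}
    {A : E3 →L[ℝ] E3} (hA : Adm A) {ε : ℝ} : ¬ Near (∅ : Set E3) c ρ t A ε := by
  intro hN
  obtain ⟨z, hz, hzc⟩ := exists_site_near_sharp hA (t 0) c
  obtain ⟨p, hp, _⟩ := hN.2 0 z hz (hzc.trans hρ)
  exact hp

/-- Configurations form: for `ρ ≥ 199/200` the empty configuration `Fin 0 → ℝ³` has no fine ball.
[folklore] -/
theorem fineGrains_matrix_fails_empty {ρ : ℝ} (hρ : 199 / 200 ≤ ρ) (ε : ℝ) (x : Fin 0 → E3) :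
    ¬ ∃ (c : E3) (t : Fin 2 → E3) (A : E3 →L[ℝ] E3), Adm A ∧ Near (Set.range x) c ρ t A ε := by
  rintro ⟨c, t, A, hA, hN⟩
  have hx : Set.range x = ∅ := Set.range_eq_empty x
  rw [hx] at hN
  exact not_near_empty_of_le hρ hA hN

end Summit.AtomisticToContinuum.Crystallization.Theorems.FineGrains.Negative.RadiusVacuity

end
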